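import Literature.AnabelianGeometry.AbsoluteAnabelian.UnitKummerCyclotomeJunctionFundamental
import Literature.AnabelianGeometry.AbsoluteAnabelian.UnitKummerCyclotomeJunctionTLGTwist
import Literature.AnabelianGeometry.AbsoluteAnabelian.UnitKummerCyclotomeJunctionEquivariance
import HarnessLib

/-!
# [AbsTopIII] Prop 3.3 (i) clause (c) through THE junction: choice-freeness, the `{±1}`-robustness, exact dependence
# on the reciprocity datum, equivariance — PROOFS

S. Mochizuki, *Topics in absolute anabelian geometry III*, §3, Prop. 3.3 (i) p. 73 (bib key `MochizukiAbsTopIII2015`):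
for `T = TLG` «the natural isomorphism `μ_Ẑ(M) ⥲ μ_Ẑ(G)` [cf. Remark 3.2.1] is only determined up to a `{±1}`-multiple»
(resp. `Ẑ^×` for `T = TCG`); Rmk. 3.2.1 p. 73; [AbsAnab] Prop. 1.2.1 (vi) p. 10–11 (bib key `MochizukiAbsAnab2004`).

abc-iut cell, layer L4, node AbsTopIII:Prop3.3(i), row «P33i-TLG-FUND-JUNCTION» (seat abc-iut-w4-d009 gen 5).  PROOF-ONLY
companion of `UnitKummerCyclotomeJunctionFundamental.lean` (THE junction `MLFClosure.cyclotomeUnitsEquivMuZhatFund`, the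
presented theories `TLG/TCGPresentation.unitKummerTheoryMuZhatFund`), over abc-iut-w6-d022's `TorsionReciprocityData.fundamental`
(p437130: unique ON THE NOSE) and the twist criterion of `UnitKummerCyclotomeJunctionTLGTwist.lean` (p441869):

* CHOICE-FREENESS: `cyclotomeUnitsEquivMuZhatOf_eq_fund`, `unitKummerTheoryMuZhatOf_eq_fund` — EVERY fundamental datum gives
  THE junction / THE theory (structure equality, `IsFundamental.unique`);
* THE `{±1}` OF PRINT, EXACTLY: `unitKummerTheoryMuZhatOf_cycIsoClass_eq_fund_of_inv_twist` — the INVERSE TWIST of a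
  fundamental datum (the opposite normalisation of the reciprocity map; NOT fundamental,
  `IsFundamental.not_isFundamental_of_inv_twist`) gives the SAME `TLG` class; `unitKummerTheoryMuZhatFund_cycIsoClass_eq_of_iff` —
  and NOTHING weaker does: the class built from `D` is THE class iff `D.muZhatEquiv ∈ {fund.muZhatEquiv, fund.muZhatEquiv ≫ inv}`;
* HONEST BOOKKEEPING: `unitKummerTheoryMuZhatFund_cycIsoClass_eq_muZhat_iff` — p432997's chosen-datum `π.unitKummerTheoryMuZhat`
  has THE class iff the chosen datum is `±`-fundamental (nothing decides this for `Classical.choice`; consumers wanting print's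
  natural isomorphism use `…Fund`); for `TCG` the two agree outright (`TCGPresentation.unitKummerTheoryMuZhatFund_cycIsoClass_eq_muZhat`);
* torsor and naturality-in-the-presentation clauses for THE theory (`…Fund_torsor`, `…Fund_canonical`), and the `G_k`- and
  `Π_k`-EQUIVARIANCE of the junction of ANY datum, hence of THE junction (generic forms of p433629).

ELABORATION NOTE: equalities of classes of two re-targetings are written `@Eq (Set (μ_Ẑ(M) ≃* μ_Ẑ(G_k))) lhs rhs` (type first;
see `UnitKummerCyclotomeJunctionTLGTwist.lean`).  HONEST FRAMING: classical (local class field theory + Kummer theory at OUR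
model objects); nothing here bears on [IUTchIII] Cor. 3.12; no side taken; typed ≠ proved.
-/

noncomputable section

namespace Literature.AnabelianGeometry.AbsoluteAnabelian

universe u

/-! ### The junctions: choice-freeness, inverse twist, equivariance -/

namespace MLFClosure

variable (C : MLFClosure.{u})

/-- **Every fundamental datum gives THE junction** (`IsFundamental.unique`). [cite: MochizukiAbsAnab2004, Prop 1.2.1 (vi) p.11] -/
theorem cyclotomeUnitsEquivMuZhatOf_eq_fund {D : TorsionReciprocityData C.k} (hD : D.IsFundamental) :
    C.cyclotomeUnitsEquivMuZhatOf D = C.cyclotomeUnitsEquivMuZhatFund := by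
  rw [hD.eq_fundamental]
  rfl

/-- The junction of the inverse twist `D'` of `D` is the junction of `D` followed by inversion of `μ_Ẑ(G_k)`.
[cite: MochizukiAbsTopIII2015, Remark 3.2.1 p.73] -/
theorem cyclotomeUnitsEquivMuZhatOf_of_inv_twist {D D' : TorsionReciprocityData C.k}
    (h : ∀ (U : OpenSubgroup (Field.absoluteGaloisGroup C.k))
      (x : abelianizationTorsion (U : Subgroup (Field.absoluteGaloisGroup C.k))), D'.θ U x = (D.θ U x)⁻¹) :
    C.cyclotomeUnitsEquivMuZhatOf D' = (C.cyclotomeUnitsEquivMuZhatOf D).trans (MulEquiv.inv _) := by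
  unfold cyclotomeUnitsEquivMuZhatOf
  rw [TorsionReciprocityData.muZhatEquiv_symm_eq_of_inv_twist h, MulEquiv.inv_trans_eq_trans_inv]
  rfl

/-- **`G_k`-equivariance of the junction of ANY datum** (inverse form, componentwise): `junction⁻¹ (σ • η)` has components
`(ε⁻¹ σ ε)` of those of `junction⁻¹ η` — abc-iut-L4-t17's `muZhatEquiv_smul_coe` through `ε : k̄ ≃ₐ[k] k^alg`.
[cite: MochizukiAbsTopIII2015, Remark 3.2.1 p.73] -/
theorem cyclotomeUnitsEquivMuZhatOf_symm_smul_coe (D : TorsionReciprocityData C.k) (σ : Field.absoluteGaloisGroup C.k)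
    (η : muZhat (Field.absoluteGaloisGroup C.k)) (n : ℕ+) :
    ((((C.cyclotomeUnitsEquivMuZhatOf D).symm (σ • η) : EtaleTheta.cyclotome (C.K)ˣ) : ℕ+ → (C.K)ˣ) n : C.K) =
      AlgEquiv.autCongr (IsAlgClosure.equiv C.k C.K (AlgebraicClosure C.k)).symm σ
        (((((C.cyclotomeUnitsEquivMuZhatOf D).symm η : EtaleTheta.cyclotome (C.K)ˣ) : ℕ+ → (C.K)ˣ) n : C.K)) := by
  -- adapted from `cyclotomeUnitsEquivMuZhat_symm_smul_coe` (UnitKummerCyclotomeJunctionEquivariance.lean, p433629)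
  rw [cyclotomeUnitsEquivMuZhatOf_symm_apply_coe, cyclotomeUnitsEquivMuZhatOf_symm_apply_coe,
    D.muZhatEquiv_smul_coe σ η n, AlgEquiv.autCongr_apply, AlgEquiv.trans_apply, AlgEquiv.trans_apply,
    AlgEquiv.symm_symm, AlgEquiv.apply_symm_apply]
  rfl

/-- **`G_k`-equivariance of THE junction** (inverse form, componentwise). [cite: MochizukiAbsTopIII2015, Remark 3.2.1 p.73] -/
theorem cyclotomeUnitsEquivMuZhatFund_symm_smul_coe (σ : Field.absoluteGaloisGroup C.k)
    (η : muZhat (Field.absoluteGaloisGroup C.k)) (n : ℕ+) :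
    (((C.cyclotomeUnitsEquivMuZhatFund.symm (σ • η) : EtaleTheta.cyclotome (C.K)ˣ) : ℕ+ → (C.K)ˣ) n : C.K) =
      AlgEquiv.autCongr (IsAlgClosure.equiv C.k C.K (AlgebraicClosure C.k)).symm σ
        ((((C.cyclotomeUnitsEquivMuZhatFund.symm η : EtaleTheta.cyclotome (C.K)ˣ) : ℕ+ → (C.K)ˣ) n : C.K)) :=
  C.cyclotomeUnitsEquivMuZhatOf_symm_smul_coe _ σ η n

end MLFClosure

namespace ModelMLFGaloisData

variable {C : MLFClosure.{u}} (D : ModelMLFGaloisData C.k C.K)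

/-- **`Π_k`-equivariance of the junction of ANY datum `R` at the model data**: `junction (g • ζ) = (ε ∘ ε_k(g) ∘ ε⁻¹) • junction ζ`.
[cite: MochizukiAbsTopIII2015, Proposition 3.3 (i) p.73] -/
theorem cyclotomeUnitsEquivMuZhatOf_smul (R : TorsionReciprocityData C.k) (g : D.Pi) (ζ : EtaleTheta.cyclotome (C.K)ˣ)
    (σ : Field.absoluteGaloisGroup C.k)
    (hσ : σ = AlgEquiv.autCongr (IsAlgClosure.equiv C.k C.K (AlgebraicClosure C.k)) (D.aug g)) :
    C.cyclotomeUnitsEquivMuZhatOf R (g • ζ) = σ • C.cyclotomeUnitsEquivMuZhatOf R ζ := by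
  -- adapted from `cyclotomeUnitsEquivMuZhat_smul` (UnitKummerCyclotomeJunctionEquivariance.lean, p433629)
  subst hσ
  apply (C.cyclotomeUnitsEquivMuZhatOf R).symm.injective
  rw [MulEquiv.symm_apply_apply]
  refine Subtype.ext (funext fun n => Units.ext ?_)
  rw [C.cyclotomeUnitsEquivMuZhatOf_symm_smul_coe, ← AlgEquiv.autCongr_symm, MulEquiv.symm_apply_apply,
    MulEquiv.symm_apply_apply, EtaleTheta.cyclotome.smul_apply, units_coe_smul]
  rfl

/-- **`Π_k`-equivariance of THE junction at the model data.** [cite: MochizukiAbsTopIII2015, Proposition 3.3 (i) p.73] -/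
theorem cyclotomeUnitsEquivMuZhatFund_smul (g : D.Pi) (ζ : EtaleTheta.cyclotome (C.K)ˣ) :
    C.cyclotomeUnitsEquivMuZhatFund (g • ζ) =
      (show Field.absoluteGaloisGroup C.k from
          AlgEquiv.autCongr (IsAlgClosure.equiv C.k C.K (AlgebraicClosure C.k)) (D.aug g)) •
        C.cyclotomeUnitsEquivMuZhatFund ζ :=
  D.cyclotomeUnitsEquivMuZhatOf_smul _ g ζ _ rfl

end ModelMLFGaloisData

/-! ### THE presented `TLG` theory: torsor, naturality, choice-freeness, the `{±1}`, exact dependence -/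

namespace GaloisMonoidPair

namespace TLGPresentation

variable {P : GaloisMonoidPair.{0}} (π : P.TLGPresentation)

/-- **Prop 3.3 (i) clause (c), `TLG`, against THE `μ_Ẑ(G_k)`**: any two members of the class differ by `±1`.
[cite: MochizukiAbsTopIII2015, Proposition 3.3 (i) p.73] -/
theorem unitKummerTheoryMuZhatFund_torsor (e₁ e₂ : cyclotome P.M ≃* muZhat (Field.absoluteGaloisGroup π.C.k))
    (he₁ : e₁ ∈ π.unitKummerTheoryMuZhatFund.cycIsoClass) (he₂ : e₂ ∈ π.unitKummerTheoryMuZhatFund.cycIsoClass) :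
    ∃ v : cyclotome P.M ≃* cyclotome P.M, (v = MulEquiv.refl _ ∨ v = MulEquiv.inv (cyclotome P.M)) ∧
      ∀ ζ, e₂ ζ = e₁ (v ζ) := by
  obtain ⟨v, hv, h⟩ := π.unitKummerTheoryMuZhatFund.cycIsoClass_torsor e₁ he₁ e₂ he₂
  exact ⟨v, hv rfl, h⟩

/-- **Naturality in the presentation**: the canonical identification of carriers of two `TLG` presentations carries the Kummer
classes of `π₁.unitKummerTheoryMuZhatFund` to those of `π₂.unitKummerTheoryMuZhatFund`. [cite: MochizukiAbsTopIII2015, Proposition 3.3 (i) p.73] -/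
theorem unitKummerTheoryMuZhatFund_canonical (π₁ π₂ : P.TLGPresentation) (H : OpenSubgroup P.Pi)
    (m : {m : P.M // ∀ h : H, (h : P.Pi) • m = m}) :
    canonicalEquiv π₁ π₂ H (π₁.unitKummerTheoryMuZhatFund.kummer H m) = π₂.unitKummerTheoryMuZhatFund.kummer H m :=
  canonicalEquiv_kummer π₁ π₂ H m

/-- **Every fundamental datum gives THE theory** (structure equality; `IsFundamental.unique`).
[cite: MochizukiAbsAnab2004, Prop 1.2.1 (vi) p.11] -/
theorem unitKummerTheoryMuZhatOf_eq_fund {D : TorsionReciprocityData π.C.k} (hD : D.IsFundamental) :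
    π.unitKummerTheoryMuZhatOf D = π.unitKummerTheoryMuZhatFund := by
  rw [hD.eq_fundamental]
  rfl

/-- Any two fundamental data give the same theory. [cite: MochizukiAbsAnab2004, Prop 1.2.1 (vi) p.11] -/
theorem unitKummerTheoryMuZhatOf_eq_of_isFundamental {D₁ D₂ : TorsionReciprocityData π.C.k} (h₁ : D₁.IsFundamental)
    (h₂ : D₂.IsFundamental) : π.unitKummerTheoryMuZhatOf D₁ = π.unitKummerTheoryMuZhatOf D₂ := by
  rw [h₁.unique h₂]

/-- **Twist criterion for `…Of`**: the classes built from `D₁`, `D₂` coincide iff the `Ẑ`-identifications are equal or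
inverse-twisted. [cite: MochizukiAbsTopIII2015, Proposition 3.3 (i) p.73] -/
theorem unitKummerTheoryMuZhatOf_cycIsoClass_eq_iff (D₁ D₂ : TorsionReciprocityData π.C.k) :
    @Eq (Set (cyclotome P.M ≃* muZhat (Field.absoluteGaloisGroup π.C.k)))
        (π.unitKummerTheoryMuZhatOf D₁).cycIsoClass (π.unitKummerTheoryMuZhatOf D₂).cycIsoClass ↔
      (D₂.muZhatEquiv = D₁.muZhatEquiv ∨ D₂.muZhatEquiv = D₁.muZhatEquiv.trans (MulEquiv.inv _)) :=
  (π.mapCyclotome_cycIsoClass_eq_iff _ _).trans (or_congr (π.junction_eq_iff D₂ D₁) (π.junction_eq_trans_inv_iff D₂ D₁))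

/-- **Print's `{±1}` absorbs exactly the sign convention of local class field theory**: the INVERSE TWIST `D'` of a
fundamental datum `D` — the datum of the opposite normalisation of the reciprocity map, which is NOT fundamental
(`IsFundamental.not_isFundamental_of_inv_twist`) — gives the SAME `TLG` class as THE junction.
[cite: MochizukiAbsTopIII2015, Proposition 3.3 (i) p.73] -/
theorem unitKummerTheoryMuZhatOf_cycIsoClass_eq_fund_of_inv_twist {D D' : TorsionReciprocityData π.C.k}
    (hD : D.IsFundamental)
    (h : ∀ (U : OpenSubgroup (Field.absoluteGaloisGroup π.C.k))
      (x : abelianizationTorsion (U : Subgroup (Field.absoluteGaloisGroup π.C.k))), D'.θ U x = (D.θ U x)⁻¹) :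
    @Eq (Set (cyclotome P.M ≃* muZhat (Field.absoluteGaloisGroup π.C.k)))
      π.unitKummerTheoryMuZhatFund.cycIsoClass (π.unitKummerTheoryMuZhatOf D').cycIsoClass := by
  obtain rfl := hD.eq_fundamental
  exact (π.unitKummerTheoryMuZhatOf_cycIsoClass_eq_iff _ D').mpr
    (Or.inr (TorsionReciprocityData.muZhatEquiv_eq_of_inv_twist h))

/-- A datum and its inverse twist ALWAYS give the same `TLG` class (in particular both normalisations of local class field
theory give THE class). [cite: MochizukiAbsTopIII2015, Proposition 3.3 (i) p.73] -/
theorem unitKummerTheoryMuZhatOf_cycIsoClass_eq_of_inv_twist {D D' : TorsionReciprocityData π.C.k}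
    (h : ∀ (U : OpenSubgroup (Field.absoluteGaloisGroup π.C.k))
      (x : abelianizationTorsion (U : Subgroup (Field.absoluteGaloisGroup π.C.k))), D'.θ U x = (D.θ U x)⁻¹) :
    @Eq (Set (cyclotome P.M ≃* muZhat (Field.absoluteGaloisGroup π.C.k)))
      (π.unitKummerTheoryMuZhatOf D).cycIsoClass (π.unitKummerTheoryMuZhatOf D').cycIsoClass :=
  (π.unitKummerTheoryMuZhatOf_cycIsoClass_eq_iff D D').mpr (Or.inr (TorsionReciprocityData.muZhatEquiv_eq_of_inv_twist h))

/-- **Exact dependence on the datum**: the class built from `D` is THE class iff `D.muZhatEquiv` is THE identification or its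
inverse twist — a `{±1}`-normalised datum suffices for `TLG`, and nothing weaker does. [cite: MochizukiAbsTopIII2015, Proposition 3.3 (i) p.73] -/
theorem unitKummerTheoryMuZhatFund_cycIsoClass_eq_of_iff (D : TorsionReciprocityData π.C.k) :
    @Eq (Set (cyclotome P.M ≃* muZhat (Field.absoluteGaloisGroup π.C.k)))
        π.unitKummerTheoryMuZhatFund.cycIsoClass (π.unitKummerTheoryMuZhatOf D).cycIsoClass ↔
      (D.muZhatEquiv = (TorsionReciprocityData.fundamental π.C.k).muZhatEquiv ∨
        D.muZhatEquiv = (TorsionReciprocityData.fundamental π.C.k).muZhatEquiv.trans (MulEquiv.inv _)) :=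
  π.unitKummerTheoryMuZhatOf_cycIsoClass_eq_iff _ D

/-- Contrapositive: a datum whose `Ẑ`-identification is NEITHER THE one NOR its inverse twist gives a DIFFERENT `TLG` class.
[cite: MochizukiAbsTopIII2015, Proposition 3.3 (i) p.73] -/
theorem unitKummerTheoryMuZhatFund_cycIsoClass_ne_of (D : TorsionReciprocityData π.C.k)
    (h₁ : D.muZhatEquiv ≠ (TorsionReciprocityData.fundamental π.C.k).muZhatEquiv)
    (h₂ : D.muZhatEquiv ≠ (TorsionReciprocityData.fundamental π.C.k).muZhatEquiv.trans (MulEquiv.inv _)) :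
    ¬ @Eq (Set (cyclotome P.M ≃* muZhat (Field.absoluteGaloisGroup π.C.k)))
        π.unitKummerTheoryMuZhatFund.cycIsoClass (π.unitKummerTheoryMuZhatOf D).cycIsoClass :=
  fun h => ((π.unitKummerTheoryMuZhatFund_cycIsoClass_eq_of_iff D).mp h).elim h₁ h₂

/-- **Honest bookkeeping for p432997's chosen-datum theory**: `π.unitKummerTheoryMuZhat` has THE class iff the chosen datum's
`Ẑ`-identification is THE one or its inverse twist (nothing decides this for `Classical.choice`; consumers wanting print's
natural isomorphism use `unitKummerTheoryMuZhatFund`). [cite: MochizukiAbsTopIII2015, Proposition 3.3 (i) p.73] -/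
theorem unitKummerTheoryMuZhatFund_cycIsoClass_eq_muZhat_iff :
    @Eq (Set (cyclotome P.M ≃* muZhat (Field.absoluteGaloisGroup π.C.k)))
        π.unitKummerTheoryMuZhatFund.cycIsoClass π.unitKummerTheoryMuZhat.cycIsoClass ↔
      (π.C.reciprocityData.muZhatEquiv = (TorsionReciprocityData.fundamental π.C.k).muZhatEquiv ∨
        π.C.reciprocityData.muZhatEquiv =
          (TorsionReciprocityData.fundamental π.C.k).muZhatEquiv.trans (MulEquiv.inv _)) :=
  π.unitKummerTheoryMuZhatFund_cycIsoClass_eq_of_iff π.C.reciprocityData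

end TLGPresentation

/-! ### The `TCG` twin: the choice never mattered -/

namespace TCGPresentation

variable {P : GaloisMonoidPair.{0}} (π : P.TCGPresentation)

/-- **Prop 3.3 (i) clause (c), `TCG`, against THE `μ_Ẑ(G_k)`**: any two members differ by an automorphism of `μ_Ẑ(M)` and the
class is closed under all of them (`Ẑ^×`-torsor). [cite: MochizukiAbsTopIII2015, Proposition 3.3 (i) p.73] -/
theorem unitKummerTheoryMuZhatFund_torsor :
    (∀ e₁ ∈ π.unitKummerTheoryMuZhatFund.cycIsoClass, ∀ e₂ ∈ π.unitKummerTheoryMuZhatFund.cycIsoClass,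
      ∃ v : cyclotome P.M ≃* cyclotome P.M, ∀ ζ, e₂ ζ = e₁ (v ζ)) ∧
    (∀ e₁ ∈ π.unitKummerTheoryMuZhatFund.cycIsoClass, ∀ v : cyclotome P.M ≃* cyclotome P.M,
      ∃ e₂ ∈ π.unitKummerTheoryMuZhatFund.cycIsoClass, ∀ ζ, e₂ ζ = e₁ (v ζ)) :=
  ⟨fun e₁ he₁ e₂ he₂ => by
    obtain ⟨v, -, h⟩ := π.unitKummerTheoryMuZhatFund.cycIsoClass_torsor e₁ he₁ e₂ he₂
    exact ⟨v, h⟩,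
  fun e₁ he₁ v => π.unitKummerTheoryMuZhatFund.cycIsoClass_full e₁ he₁ v (fun h => PairType.noConfusion h)⟩

/-- **For `TCG` THE theory and the chosen-datum theory have the same class** (`Ẑ^×` absorbs every re-targeting,
`mapCyclotome_cycIsoClass_eq_of_TCG`). [cite: MochizukiAbsTopIII2015, Proposition 3.3 (i) p.73] -/
theorem unitKummerTheoryMuZhatFund_cycIsoClass_eq_muZhat :
    @Eq (Set (cyclotome P.M ≃* muZhat (Field.absoluteGaloisGroup π.C.k)))
      π.unitKummerTheoryMuZhatFund.cycIsoClass π.unitKummerTheoryMuZhat.cycIsoClass :=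
  π.unitKummerTheory.mapCyclotome_cycIsoClass_eq_of_TCG _ _

/-- … and the same class as the re-targeting along the junction of ANY datum. [cite: MochizukiAbsTopIII2015, Proposition 3.3 (i) p.73] -/
theorem unitKummerTheoryMuZhatFund_cycIsoClass_eq_of (D : TorsionReciprocityData π.C.k) :
    @Eq (Set (cyclotome P.M ≃* muZhat (Field.absoluteGaloisGroup π.C.k)))
      π.unitKummerTheoryMuZhatFund.cycIsoClass (π.unitKummerTheory.mapCyclotome (π.C.cyclotomeUnitsEquivMuZhatOf D)).cycIsoClass :=
  π.unitKummerTheory.mapCyclotome_cycIsoClass_eq_of_TCG _ _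

end TCGPresentation

end GaloisMonoidPair

end Literature.AnabelianGeometry.AbsoluteAnabelian

end
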